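import Summits.QuantumFields.BalabanUV.Beta.EriceFlowEnclosureB12AsPrintedHistoryContagionShiftFlowZeroSemigroupGellMannLowSmooth
import Summits.QuantumFields.BalabanUV.Beta.EriceFlowEnclosureB12AsPrintedHistoryContagionShiftFlowZeroSemigroupExact

/-!
# Beta / EriceFlowEnclosureB12AsPrintedHistoryContagionShiftFlowZeroSemigroupGellMannLowExact — ASYMPTOTIC FREEDOM IS CONTAGIOUS, part 61: THE EXACTLY SOLUBLE CASE OF THE
# INFINITESIMAL RENORMALIZATION GROUP — for the memoryless constant functional `B ≡ 1` (part 52's toy; NOT Bałaban's β: C_m = 0, β₀ = 1, κ = 0) every hypothesis of the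
# smooth theory (part 60) is INHABITED WITH EQUALITIES: the Λ-coordinate `Λ g = 1∕g² − 1∕e′²` has derivative **`D(g) = −2∕g³` EVERYWHERE** (`const_hasDerivAt`), the chart
# bounds hold (`const_chart_bounds`), the continuous RG is `φ_s g = (1∕g² + s)^{−1∕2}` (part 52), and THE GELL-MANN–LOW ODE IS THE ONE-LOOP EQUATION ON THE NOSE:
# **`∂_s φ_s g = β₀∕D(φ_s g) = −φ_s(g)³∕2`** (**`const_velocity`** from part 60's abstract theorem; **`const_velocity_closedForm`** by differentiating the closed form —
# the two agree), the relative defect of part 57 VANISHES IDENTICALLY (`const_generator_exact`: `(−2∕(β₀φ³))·V − 1 = 0`, κ = 0), the pin derivative is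
# `∂_g φ_s g = (φ_s g∕g)³` (`const_pin_derivative`), and RG time is `s = ∫_{φ_s g}^{g} 2∕x³ dx` exactly (`const_rg_time_integral`).  Non-vacuity companion of parts 55–60:
# their abstract hypotheses (strict antitonicity, onto, chart bounds, everywhere-derivative D, continuity of D) are jointly satisfiable, and in the soluble case every
# inequality of parts 56–59 is an equality.
# (β-flow team, prover 1 = recursion ∕ upper ∕ bare-coupling ∕ uniqueness side, unit `b2b-balaban-beta-bflow-p1`, gen 41; ROW AP-I·Uc × NODE U2 — the infinitesimal
# renormalization group, soluble case; over part 60 `…GellMannLowSmooth` and part 52 `…SemigroupExact` (`const_strictAntiOn`, `const_onto`, `const_rg_eq`))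

HONEST FRAMING (page 1 of everything the β sub-cell writes): discharging `BetaPertH` makes Bałaban's UV stability UNCONDITIONAL — a
real constructive-QFT result; it is NOT the continuum limit and NOT the Clay problem.  HONEST DEPENDENCY (cell reorg 2026-08-19,
verbatim): «continuum YM on T⁴ ⇐ BetaPertH ∧ nine spine estimates (0/9 proved); BetaPertH ⇐ (D1) ∧ (D4) ∧ CAP+tail; G-an2-4 gates
asym, D1 and NE2/3/4.»  THIS MODULE DISCHARGES NOTHING: [folklore] calculus on the def-free toy `B ≡ 1` (a TOY, not Bałaban's β and not a claim about it); parts 52 ∕ 60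
BY NAME.  [I] = T. Bałaban, Commun. Math. Phys. **109** (1987) 249–301 [Balaban1987RG1]: Thm 2 (0.31) p. 259 — context of the row only.

WHAT THIS FILE PROVES (0 sorry, 0 def): §98 `const_hasDerivAt`, `const_chart_bounds`, **`const_velocity`**, **`const_velocity_closedForm`**, `const_generator_exact`,
`const_pin_derivative`, **`const_rg_time_integral`**.  NOT CLAIMED: anything about Bałaban's β; `BetaPertH`; continuum; Clay.
-/

namespace Summit.QuantumFields.BalabanUV.Beta.EriceFlowEnclosureB12AsPrintedHistoryContagionShiftFlowZeroSemigroupGellMannLowExact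

open Filter Topology Set Function MeasureTheory intervalIntegral
open Summit.QuantumFields.BalabanUV.Beta.EriceFlowEnclosureB12AsPrintedHistoryContagionShiftFlowZeroSemigroupExact (const_strictAntiOn const_onto const_rg_eq)
open Summit.QuantumFields.BalabanUV.Beta.EriceFlowEnclosureB12AsPrintedHistoryContagionShiftFlowZeroSemigroupGellMannLowSmooth (rg_hasDerivAt rg_hasDerivAt_pin
  rg_time_eq_integral_generator)

noncomputable section

/-! ## §98 The toy `B ≡ 1`: every hypothesis of the smooth theory holds, every inequality is an equality -/

/-- The toy Λ-coordinate `Λ g = 1∕g² − 1∕e′²` has derivative `−2∕x³` at every `x ≠ 0`. [folklore] -/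
theorem const_hasDerivAt {e' x : ℝ} (hx : x ≠ 0) : HasDerivAt (fun g : ℝ => 1 / g ^ 2 - 1 / e' ^ 2) (-2 / x ^ 3) x := by
  have h1 : HasDerivAt (fun y : ℝ => 1 / y ^ 2) (-(↑(2 : ℕ) * x ^ (2 - 1)) / (x ^ 2) ^ 2) x :=
    ((hasDerivAt_pow 2 x).inv (pow_ne_zero 2 hx)).congr_of_eventuallyEq (Eventually.of_forall fun y => by simp [one_div])
  refine (h1.sub_const (1 / e' ^ 2)).congr_deriv ?_
  push_cast
  field_simp

/-- The toy Λ-coordinate obeys part 35's chart bounds (2∕3, 4∕3) — indeed with constants (1, 1). [folklore] -/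
theorem const_chart_bounds {e' : ℝ} : ∀ e₁ ∈ Ioc (0 : ℝ) e', ∀ e₂ ∈ Ioc (0 : ℝ) e', e₁ ≤ e₂ →
    2 / 3 * (1 / e₁ ^ 2 - 1 / e₂ ^ 2) ≤ (1 / e₁ ^ 2 - 1 / e' ^ 2) - (1 / e₂ ^ 2 - 1 / e' ^ 2) ∧
      (1 / e₁ ^ 2 - 1 / e' ^ 2) - (1 / e₂ ^ 2 - 1 / e' ^ 2) ≤ 4 / 3 * (1 / e₁ ^ 2 - 1 / e₂ ^ 2) := by
  intro e₁ h₁ e₂ h₂ h12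
  have hΔ : 0 ≤ 1 / e₁ ^ 2 - 1 / e₂ ^ 2 := by
    have := one_div_le_one_div_of_le (pow_pos h₁.1 2) (pow_le_pow_left₀ h₁.1.le h12 2)
    linarith
  constructor <;> linarith

/-- **THE GELL-MANN–LOW ODE OF THE TOY IS THE ONE-LOOP EQUATION EXACTLY** (from part 60's abstract theorem with `D = −2∕x³`, β₀ = 1): for `g ∈ ]0, e′]` and every real s
with `0 < (1∕g² − 1∕e′²) + s` (the running coupling is interior): **`∂_s φ_s g = −φ_s(g)³∕2`**. [folklore] -/
theorem const_velocity {e' g s : ℝ} (hg : g ∈ Ioc (0 : ℝ) e') (hgs : 0 < (1 / g ^ 2 - 1 / e' ^ 2) + s) :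
    HasDerivAt (fun σ : ℝ => invFunOn (fun x : ℝ => 1 / x ^ 2 - 1 / e' ^ 2) (Ioc 0 e') ((1 / g ^ 2 - 1 / e' ^ 2) + σ * 1))
      (-(invFunOn (fun x : ℝ => 1 / x ^ 2 - 1 / e' ^ 2) (Ioc 0 e') ((1 / g ^ 2 - 1 / e' ^ 2) + s * 1)) ^ 3 / 2) s := by
  have he' : 0 < e' := hg.1.trans_le hg.2
  have hD : ∀ x ∈ Ioo (0 : ℝ) e', HasDerivAt (fun g : ℝ => 1 / g ^ 2 - 1 / e' ^ 2) ((fun x : ℝ => -2 / x ^ 3) x) x :=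
    fun x hx => const_hasDerivAt hx.1.ne'
  have hgs' : (fun x : ℝ => 1 / x ^ 2 - 1 / e' ^ 2) e' < (fun x : ℝ => 1 / x ^ 2 - 1 / e' ^ 2) g + s * 1 := by
    show 1 / e' ^ 2 - 1 / e' ^ 2 < (1 / g ^ 2 - 1 / e' ^ 2) + s * 1
    linarith
  have h := rg_hasDerivAt (β₀ := 1) const_strictAntiOn (const_onto he') one_pos const_chart_bounds hD hgs'
  refine h.congr_deriv ?_
  set x := invFunOn (fun x : ℝ => 1 / x ^ 2 - 1 / e' ^ 2) (Ioc 0 e') ((1 / g ^ 2 - 1 / e' ^ 2) + s * 1) with hxdef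
  have hx0 : x ≠ 0 := by
    have hex : ∃ z ∈ Ioc (0 : ℝ) e', (fun x : ℝ => 1 / x ^ 2 - 1 / e' ^ 2) z = (1 / g ^ 2 - 1 / e' ^ 2) + s * 1 :=
      const_onto he' _ (by simp only [sub_self]; linarith)
    exact (invFunOn_mem hex).1.ne'
  show 1 / (-2 / x ^ 3) = -x ^ 3 / 2
  field_simp

/-- **… AND AGREES WITH THE CLOSED FORM**: differentiating part 52's `φ_s g = 1∕√(1∕g² + s)` directly gives `∂_s(1∕√(1∕g² + s)) = −(1∕√(1∕g² + s))³∕2` wherever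
`1∕g² + s > 0`. [folklore] -/
theorem const_velocity_closedForm {g s : ℝ} (hS : 0 < 1 / g ^ 2 + s) :
    HasDerivAt (fun σ : ℝ => 1 / Real.sqrt (1 / g ^ 2 + σ)) (-(1 / Real.sqrt (1 / g ^ 2 + s)) ^ 3 / 2) s := by
  have hinner : HasDerivAt (fun σ : ℝ => 1 / g ^ 2 + σ) 1 s := (hasDerivAt_id s).const_add (1 / g ^ 2)
  have hsqrt : HasDerivAt (fun σ : ℝ => Real.sqrt (1 / g ^ 2 + σ)) (1 / (2 * Real.sqrt (1 / g ^ 2 + s))) s := by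
    simpa using hinner.sqrt hS.ne'
  have hne : Real.sqrt (1 / g ^ 2 + s) ≠ 0 := (Real.sqrt_pos.2 hS).ne'
  have h := hsqrt.inv hne
  have h' : HasDerivAt (fun σ : ℝ => 1 / Real.sqrt (1 / g ^ 2 + σ)) (-(1 / (2 * Real.sqrt (1 / g ^ 2 + s))) / Real.sqrt (1 / g ^ 2 + s) ^ 2) s :=
    h.congr_of_eventuallyEq (Eventually.of_forall fun σ => by simp [one_div])
  refine h'.congr_deriv ?_
  field_simp

/-- **THE ONE-LOOP DEFECT VANISHES IDENTICALLY**: with velocity `V = −x³∕2` at running coupling `x ≠ 0` and β₀ = 1, part 57's relative defect `(−2∕(β₀x³))·V − 1` is `0` (κ ∝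
C_m = 0). [folklore] -/
theorem const_generator_exact {x : ℝ} (hx : x ≠ 0) : -2 / (1 * x ^ 3) * (-x ^ 3 / 2) - 1 = 0 := by
  field_simp
  ring

/-- **THE PIN DERIVATIVE OF THE TOY**: for an interior pin g and `0 < (1∕g² − 1∕e′²) + s`: `∂_g φ_s g = D(g)∕D(φ_s g) = (φ_s g∕g)³`. [folklore] -/
theorem const_pin_derivative {e' g s : ℝ} (hg : g ∈ Ioo (0 : ℝ) e') (hgs : 0 < (1 / g ^ 2 - 1 / e' ^ 2) + s) :
    HasDerivAt (fun g' : ℝ => invFunOn (fun x : ℝ => 1 / x ^ 2 - 1 / e' ^ 2) (Ioc 0 e') ((1 / g' ^ 2 - 1 / e' ^ 2) + s * 1))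
      ((invFunOn (fun x : ℝ => 1 / x ^ 2 - 1 / e' ^ 2) (Ioc 0 e') ((1 / g ^ 2 - 1 / e' ^ 2) + s * 1) / g) ^ 3) g := by
  have he' : 0 < e' := hg.1.trans hg.2
  have hD : ∀ x ∈ Ioo (0 : ℝ) e', HasDerivAt (fun g : ℝ => 1 / g ^ 2 - 1 / e' ^ 2) ((fun x : ℝ => -2 / x ^ 3) x) x :=
    fun x hx => const_hasDerivAt hx.1.ne'
  have hgs' : (fun x : ℝ => 1 / x ^ 2 - 1 / e' ^ 2) e' < (fun x : ℝ => 1 / x ^ 2 - 1 / e' ^ 2) g + s * 1 := by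
    show 1 / e' ^ 2 - 1 / e' ^ 2 < (1 / g ^ 2 - 1 / e' ^ 2) + s * 1
    linarith
  have h := rg_hasDerivAt_pin (β₀ := 1) const_strictAntiOn (const_onto he') one_pos const_chart_bounds hD hg hgs'
  refine h.congr_deriv ?_
  set x := invFunOn (fun x : ℝ => 1 / x ^ 2 - 1 / e' ^ 2) (Ioc 0 e') ((1 / g ^ 2 - 1 / e' ^ 2) + s * 1) with hxdef
  have hx0 : x ≠ 0 := by
    have hex : ∃ z ∈ Ioc (0 : ℝ) e', (fun x : ℝ => 1 / x ^ 2 - 1 / e' ^ 2) z = (1 / g ^ 2 - 1 / e' ^ 2) + s * 1 :=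
      const_onto he' _ (by simp only [sub_self]; linarith)
    exact (invFunOn_mem hex).1.ne'
  have hg0 : g ≠ 0 := hg.1.ne'
  show -2 / g ^ 3 / (-2 / x ^ 3) = (x / g) ^ 3
  field_simp

/-- **RG TIME OF THE TOY IS `∫ 2∕x³` EXACTLY**: for an interior pin g and `s ≥ 0`, **`s = ∫_{φ_s g}^{g} 2∕x³ dx`** with `φ_s g = 1∕√(1∕g² + s)` — part 60's
`s = ∫ dg∕|β_c|` with `|β_c(x)| = x³∕2`, on the nose. [folklore] -/
theorem const_rg_time_integral {e' g s : ℝ} (hg : g ∈ Ioo (0 : ℝ) e') (hs : 0 ≤ s) :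
    s = ∫ x in (1 / Real.sqrt (1 / g ^ 2 + s))..g, 2 / x ^ 3 := by
  have he' : 0 < e' := hg.1.trans hg.2
  have hgmem : g ∈ Ioc (0 : ℝ) e' := ⟨hg.1, hg.2.le⟩
  have hD : ∀ x ∈ Ioo (0 : ℝ) e', HasDerivAt (fun g : ℝ => 1 / g ^ 2 - 1 / e' ^ 2) ((fun x : ℝ => -2 / x ^ 3) x) x :=
    fun x hx => const_hasDerivAt hx.1.ne'
  have h := rg_time_eq_integral_generator (β₀ := 1) const_strictAntiOn (const_onto he') one_pos const_chart_bounds hD hg hs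
  rw [const_rg_eq hgmem hs] at h
  refine h.trans ?_
  refine intervalIntegral.integral_congr fun x _ => ?_
  show -(-2 / x ^ 3) / 1 = 2 / x ^ 3
  ring

end

end Summit.QuantumFields.BalabanUV.Beta.EriceFlowEnclosureB12AsPrintedHistoryContagionShiftFlowZeroSemigroupGellMannLowExact
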